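import Literature.Geometry.Riemannian.GeodesicFlowSmooth
import HarnessLib

/-!
# The rescaling lemma for maximal geodesics (Lee 2018, Lemma 5.18, Prop. 5.19 (b))

Layer 3a of the proof programme for `Literature.Geometry.Riemannian.lee_expMap_injectivityDomain`
(Lee 2018, Thm. 10.34). For a `C¹` connection `cov` on the tangent bundle of a Hausdorff manifold
without boundary, with maximal geodesics `γ_v = maximalGeodesic cov x v` and exponential map
`exp_x = expMap cov x` of `ExponentialMap.lean`:

* `maximalGeodesic_smul_of_mem` — **Lee, Lemma 5.18** ("`γ_{cv}(t) = γ_v(ct)` whenever either side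
  is defined"): `ct ∈ dom γ_v` implies `t ∈ dom γ_{cv}` and `γ_{cv}(t) = γ_v(ct)` (no
  completeness; the complete case is `maximalGeodesic_smul` of `ExponentialMapProofs.lean`);
* `mem_maximalGeodesicDomain_iff_smul_mem_expDomain` — `t ∈ dom γ_v ↔ tv ∈ 𝓔_x`, and
  `expMap_smul_of_mem` — **Lee, Prop. 5.19 (b)**: `exp_x(tv) = γ_v(t)` for `t ∈ dom γ_v`.

No definitions, no named facts (D-0026).

## References

* J. M. Lee, *Introduction to Riemannian Manifolds*, 2nd ed. (2018), Lemma 5.18, Prop. 5.19 (b).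
  [LeeRiemannianManifolds2018]
-/

noncomputable section

open Bundle Set Filter
open scoped Manifold ContDiff Topology

namespace Literature.Geometry.Riemannian

open Literature.Geometry.Lorentzian

variable {E : Type*} [NormedAddCommGroup E] [NormedSpace ℝ E] {H : Type*} [TopologicalSpace H]
  {I : ModelWithCorners ℝ E H} {M : Type*} [TopologicalSpace M] [ChartedSpace H M]
  [IsManifold I ∞ M] [FiniteDimensional ℝ E]
  {cov : CovariantDerivative I E (TangentSpace I : M → Type _)}
  [CompleteSpace E] [T2Space M] [BoundarylessManifold I M]
  [CovariantDerivative.ContMDiffCovariantDerivative cov 1]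

/-- **Rescaling lemma** (Lee 2018, Lemma 5.18: "for every `v ∈ T_pM` and `c, t ∈ ℝ`,
`γ_{cv}(t) = γ_v(ct)` whenever either side is defined"), in the direction: if `ct ∈ dom γ_v` then
`t ∈ dom γ_{cv}` and `γ_{cv}(t) = γ_v(ct)` — the reparametrised curve `t ↦ γ_v(ct)` is a geodesic
(`IsGeodesicOn.comp_affine_holds`) on an open interval about `0` with initial data `(x, cv)`, hence
a restriction of `γ_{cv}` (`subset_maximalGeodesicDomain_of_isGeodesicOn`).
[cite: LeeRiemannianManifolds2018, Lemma 5.18] -/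
theorem maximalGeodesic_smul_of_mem (x : M) (v : TangentSpace I x) (c : ℝ) {t : ℝ}
    (ht : c * t ∈ maximalGeodesicDomain cov x v) :
    t ∈ maximalGeodesicDomain cov x (c • v) ∧
      maximalGeodesic cov x (c • v) t = maximalGeodesic cov x v (c * t) := by
  obtain ⟨hmax, h0, hx0, hv0⟩ := maximalGeodesic_spec' (cov := cov) x v
  set γ := maximalGeodesic cov x v with hγ
  set D := maximalGeodesicDomain cov x v with hD
  set β : ℝ → M := fun t ↦ γ (c * t + 0) with hβ
  set D' : Set ℝ := (fun t ↦ c * t + 0) ⁻¹' D with hD'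
  have hβgeo : IsGeodesicOn cov β D' := IsGeodesicOn.comp_affine_holds hmax.isGeodesicOn c 0
  have hD'o : IsOpen D' :=
    hmax.isOpen.preimage ((continuous_const.mul continuous_id).add continuous_const)
  have hD'c : D'.OrdConnected := by
    refine ⟨fun a ha b hb u hu ↦ ?_⟩
    show c * u + 0 ∈ D
    have ha' : c * a ∈ D := by simpa using (show c * a + 0 ∈ D from ha)
    have hb' : c * b ∈ D := by simpa using (show c * b + 0 ∈ D from hb)
    rw [add_zero]
    refine hmax.2.1.uIcc_subset ha' hb' ?_
    rcases le_total 0 c with hc | hc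
    · exact Icc_subset_uIcc ⟨mul_le_mul_of_nonneg_left hu.1 hc, mul_le_mul_of_nonneg_left hu.2 hc⟩
    · exact Icc_subset_uIcc' ⟨mul_le_mul_of_nonpos_left hu.2 hc, mul_le_mul_of_nonpos_left hu.1 hc⟩
  have h0' : (0 : ℝ) ∈ D' := by
    show c * 0 + 0 ∈ D
    simpa using h0
  have hβ0 : β 0 = x := by
    show γ (c * 0 + 0) = x
    rw [mul_zero, add_zero]
    exact hx0
  have hβv : velocity I β 0 = c • v := by
    rw [velocity_comp_affine γ c 0 0, show c * 0 + 0 = (0 : ℝ) by ring, hv0]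
    rfl
  obtain ⟨hsub, heq⟩ := subset_maximalGeodesicDomain_of_isGeodesicOn hD'o hD'c h0' hβgeo hβ0 hβv
  have htD' : t ∈ D' := by
    show c * t + 0 ∈ D
    rwa [add_zero]
  refine ⟨hsub htD', ?_⟩
  rw [← heq htD']
  show γ (c * t + 0) = γ (c * t)
  rw [add_zero]

/-- **`exp_x(tv) = γ_v(t)` for `t ∈ dom γ_v`**, and `tv ∈ 𝓔_x` (Lee 2018, Prop. 5.19 (b): "the
geodesic `γ_v` is given by `γ_v(t) = exp(tv)` for all `t` such that either side is defined").
[cite: LeeRiemannianManifolds2018, Prop. 5.19 (b)] -/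
theorem expMap_smul_of_mem (x : M) (v : TangentSpace I x) {t : ℝ}
    (ht : t ∈ maximalGeodesicDomain cov x v) :
    t • v ∈ expDomain cov x ∧ expMap cov x (t • v) = maximalGeodesic cov x v t := by
  have h := maximalGeodesic_smul_of_mem (cov := cov) x v t (t := 1) (by rwa [mul_one])
  have hmem : t • v ∈ expDomain cov x := ⟨hasMaximalGeodesic (cov := cov) x (t • v), h.1⟩
  refine ⟨hmem, ?_⟩
  rw [expMap_of_mem hmem, h.2, mul_one]

/-- **`t ∈ dom γ_v ↔ tv ∈ 𝓔_x`** (Lee 2018, Lemma 5.18 "whenever either side is defined", with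
Prop. 5.19 (b)): the forward direction is `expMap_smul_of_mem`; conversely `1 ∈ dom γ_{tv}` gives
`t = t · 1 … ∈ dom γ_{t⁻¹ • t v} = dom γ_v` by rescaling with `t⁻¹` (`t ≠ 0`; `t = 0` is trivial).
[cite: LeeRiemannianManifolds2018, Lemma 5.18 and Prop. 5.19 (b)] -/
theorem mem_maximalGeodesicDomain_iff_smul_mem_expDomain (x : M) (v : TangentSpace I x) (t : ℝ) :
    t ∈ maximalGeodesicDomain cov x v ↔ t • v ∈ expDomain cov x := by
  refine ⟨fun ht ↦ (expMap_smul_of_mem (cov := cov) x v ht).1, fun h ↦ ?_⟩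
  rcases eq_or_ne t 0 with rfl | ht0
  · exact (maximalGeodesic_spec' (cov := cov) x v).2.1
  · have h1 : t⁻¹ * t ∈ maximalGeodesicDomain cov x (t • v) := by
      rw [inv_mul_cancel₀ ht0]
      exact h.2
    have h2 := (maximalGeodesic_smul_of_mem (cov := cov) x (t • v) t⁻¹ h1).1
    rwa [inv_smul_smul₀ ht0] at h2

/-- On `dom γ_v` the curve `t ↦ exp_x(tv)` IS the maximal geodesic `γ_v` (pointwise form of
`expMap_smul_of_mem`, as an `EqOn`). [cite: LeeRiemannianManifolds2018, Prop. 5.19 (b)] -/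
theorem eqOn_expMap_smul_maximalGeodesic (x : M) (v : TangentSpace I x) :
    EqOn (fun t : ℝ ↦ expMap cov x (t • v)) (maximalGeodesic cov x v)
      (maximalGeodesicDomain cov x v) :=
  fun _ ht ↦ (expMap_smul_of_mem (cov := cov) x v ht).2

/-- The curve `t ↦ exp_x(tv)` is a geodesic on the open interval `dom γ_v` (locality of the
geodesic equation, `IsGeodesicOn.congr_holds`). [cite: LeeRiemannianManifolds2018, Prop. 5.19 (b)] -/
theorem isGeodesicOn_expMap_smul (x : M) (v : TangentSpace I x) :
    IsGeodesicOn cov (fun t : ℝ ↦ expMap cov x (t • v)) (maximalGeodesicDomain cov x v) := by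
  obtain ⟨hmax, -, -, -⟩ := maximalGeodesic_spec' (cov := cov) x v
  exact IsGeodesicOn.congr_holds hmax.isGeodesicOn hmax.isOpen
    fun t ht ↦ ((expMap_smul_of_mem (cov := cov) x v ht).2).symm

/-- The velocity of `t ↦ exp_x(tv)` at `t ∈ dom γ_v` is `γ_v'(t)`; at `t = 0` it is `v`.
[cite: LeeRiemannianManifolds2018, Prop. 5.19 (b)] -/
theorem velocity_expMap_smul (x : M) (v : TangentSpace I x) {t : ℝ}
    (ht : t ∈ maximalGeodesicDomain cov x v) :
    velocity I (fun t : ℝ ↦ expMap cov x (t • v)) t = velocity I (maximalGeodesic cov x v) t := by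
  obtain ⟨hmax, -, -, -⟩ := maximalGeodesic_spec' (cov := cov) x v
  refine velocity_congr_of_eventuallyEq (I := I) ?_
  filter_upwards [hmax.isOpen.mem_nhds ht] with t' ht'
  exact (expMap_smul_of_mem (cov := cov) x v ht').2

/-- The velocity of `t ↦ exp_x(tv)` at `t = 0` is `v`. [cite: LeeRiemannianManifolds2018, Prop. 5.19 (b),(d)] -/
theorem velocity_expMap_smul_zero (x : M) (v : TangentSpace I x) :
    velocity I (fun t : ℝ ↦ expMap cov x (t • v)) 0 = v := by
  obtain ⟨-, h0, -, hv0⟩ := maximalGeodesic_spec' (cov := cov) x v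
  rw [velocity_expMap_smul x v h0]
  exact hv0

end Literature.Geometry.Riemannian
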